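import Mathlib
import Summits.ValiantsHypothesis.ValiantsHypothesis.Theorems.NewtonTauWeak.Negative.Zonogon
import Summits.ValiantsHypothesis.ValiantsHypothesis.Theorems.NewtonUnitEquationsNewtonTauWeakSeparatedRank
import Summits.ValiantsHypothesis.ValiantsHypothesis.Theorems.NewtonUnitEquationsNewtonTauWeakVdpDefs
import Summits.ValiantsHypothesis.ValiantsHypothesis.Theorems.NewtonUnitEquationsNewtonTauWeakStubVertexCharts
import Summits.ValiantsHypothesis.ValiantsHypothesis.Theorems.NewtonUnitEquationsNewtonTauWeakStubChartPairCount
import Summits.ValiantsHypothesis.ValiantsHypothesis.Theorems.NewtonUnitEquationsNewtonTauWeakStubProductVertices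
import Summits.ValiantsHypothesis.ValiantsHypothesis.Theorems.NewtonUnitEquationsNewtonTauWeakHexagonDelta
import Summits.ValiantsHypothesis.ValiantsHypothesis.Theorems.NewtonUnitEquationsNewtonTauWeakHexagonSeparated

/-!
# `NewtonUnitEquationsNewtonTauWeakHexagonMinorStructure`

Rung toward `stub_binomialNewtonTauCommon` (T2 = KPTT Conj. 1 at `t = 2`; crux `NewtonTauWeak`,
stmt-ValiantsHypothesis-5904), line `binomial-normal-form`, lead c3: the ALL-`K` hexagon theorem `H_K`
("`vert(Σ_{l<K} X_l(x)Y_l(y)D_l(xy)) ≤ C(K)`, degree-free") via the HOMOGENEOUS Wronskian equation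
(card `Cruxes/NewtonTauWeak/Lines/binomial-normal-form-delta-global.md` §2).

This file: `hex_structure_minor` — every determinant `det[Δ^{rows a} g_b]_{a,b<s}` of iterated `Δ`-derivatives of hexagon products `g_b = X_b·Y_b·D_b` equals `(Π_b D_b)·m` with `m` separated of rank `≤ s!·2^{Σ_a rows a}`: `Δ` kills `D_b` (`hex_delta_eq_zero_of_diag`) so `Δ^k g_b = Δ^k(X_bY_b)·D_b` by Leibniz, `Δ^k(X_bY_b)` is separated of rank `≤ 2^k` (`hex_sep_delta` iterated), and `det = Σ_σ sign σ Π_a M_{σ a, a}` (`Matrix.det_apply`) is a signed sum of `s!` products, ranks multiplying/adding by `hex_sep_mul` / `hex_sep_add` / `hex_sep_neg`.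

Conventions (inline, no definitions): `Δ` is ANY self-map of `ℂ[X,Y]` with `coeff e (Δ p) = (e₀ - e₁) · coeff e p`;
"x-only" `∀ e ∈ P.support, e 1 = 0`, "y-only" `e 0 = 0`, "diagonal" `e 0 = e 1`; "separated of rank R":
`m = Σ_{r<R} P_r·Q_r` with `P_r` x-only, `Q_r` y-only. [folklore]
-/

set_option linter.dupNamespace false

noncomputable section

namespace Summit.ValiantsHypothesis.ValiantsHypothesis.Theorems.NewtonUnitEquationsNewtonTauWeak

open scoped BigOperators
open MvPolynomial
open Literature.Computability.AlgebraicComplexity (newtonVertexCount)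
open Summit.ValiantsHypothesis.ValiantsHypothesis.Theorems.NewtonTauWeakVdp
open Summit.ValiantsHypothesis.ValiantsHypothesis.Theorems.NewtonTauWeak.Negative (vert)

/-- H4 **Structure of the Wronskian minors of hexagon products (any size, any derivative orders).** For hexagon
products `g_b = X_b·Y_b·D_b` (`b < s`) and row orders `rows : Fin s → ℕ`, the determinant `det[Δ^{rows a} g_b]` is
`(Π_b D_b) · m` with `m` separated of rank `≤ s!·2^{Σ_a rows a}`. [folklore] -/
theorem hex_structure_minor (Δ : MvPolynomial (Fin 2) ℂ → MvPolynomial (Fin 2) ℂ)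
    (hΔ : ∀ p e, coeff e (Δ p) = (((e 0 : ℕ) : ℂ) - ((e 1 : ℕ) : ℂ)) * coeff e p)
    (hL : ∀ p q, Δ (p * q) = Δ p * q + p * Δ q)
    {s : ℕ} (X Y D : Fin s → MvPolynomial (Fin 2) ℂ)
    (hX : ∀ b, ∀ e ∈ (X b).support, e 1 = 0) (hY : ∀ b, ∀ e ∈ (Y b).support, e 0 = 0)
    (hD : ∀ b, ∀ e ∈ (D b).support, e 0 = e 1) (rows : Fin s → ℕ) :
    ∃ m : MvPolynomial (Fin 2) ℂ,
      (∃ R : ℕ, R ≤ Nat.factorial s * 2 ^ (∑ a, rows a) ∧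
        ∃ P Q : Fin R → MvPolynomial (Fin 2) ℂ, (∀ r, ∀ e ∈ (P r).support, e 1 = 0) ∧
          (∀ r, ∀ e ∈ (Q r).support, e 0 = 0) ∧ m = ∑ r, P r * Q r) ∧
      (Matrix.of fun a b : Fin s => (Δ^[rows a]) (X b * Y b * D b)).det = (∏ b, D b) * m := by
  -- Step 1: `Δ` kills the diagonal factor, so it commutes past `D b` by Leibniz.
  have hD0 : ∀ b, Δ (D b) = 0 := fun b => hex_delta_eq_zero_of_diag Δ hΔ (D b) (hD b)
  have hiter : ∀ b k, Δ^[k] (X b * Y b * D b) = Δ^[k] (X b * Y b) * D b := by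
    intro b k
    induction k with
    | zero => rfl
    | succ k ih =>
      rw [Function.iterate_succ_apply', ih, hL, hD0, mul_zero, add_zero,
        Function.iterate_succ_apply']
  -- Step 2: `Δ^[k] (X b * Y b)` is separated of rank `≤ 2 ^ k`.
  have hsep : ∀ b k, ∃ R : ℕ, R ≤ 2 ^ k ∧ ∃ P Q : Fin R → MvPolynomial (Fin 2) ℂ,
      (∀ r, ∀ e ∈ (P r).support, e 1 = 0) ∧ (∀ r, ∀ e ∈ (Q r).support, e 0 = 0) ∧
        Δ^[k] (X b * Y b) = ∑ r, P r * Q r := by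
    intro b k
    induction k with
    | zero =>
      exact ⟨1, Nat.one_le_two_pow, fun _ => X b, fun _ => Y b, fun _ => hX b, fun _ => hY b,
        by simp⟩
    | succ k ih =>
      obtain ⟨R, hR, hm⟩ := ih
      refine ⟨2 * R, ?_, ?_⟩
      · rw [pow_succ']
        exact Nat.mul_le_mul (le_refl 2) hR
      · rw [Function.iterate_succ_apply']
        exact hex_sep_delta Δ hΔ hL hm
  -- Step 3: expand the determinant over permutations.
  refine ⟨∑ σ : Equiv.Perm (Fin s), ((Equiv.Perm.sign σ : ℤ) : MvPolynomial (Fin 2) ℂ) *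
      ∏ a, Δ^[rows (σ a)] (X a * Y a), ?_, ?_⟩
  · -- each signed product is separated of rank `≤ 2 ^ (∑ a, rows a)`
    have key : ∀ σ : Equiv.Perm (Fin s), ∃ R : ℕ, R ≤ 2 ^ (∑ a, rows a) ∧
        ∃ P Q : Fin R → MvPolynomial (Fin 2) ℂ, (∀ r, ∀ e ∈ (P r).support, e 1 = 0) ∧
          (∀ r, ∀ e ∈ (Q r).support, e 0 = 0) ∧
          ((Equiv.Perm.sign σ : ℤ) : MvPolynomial (Fin 2) ℂ) * ∏ a, Δ^[rows (σ a)] (X a * Y a) =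
            ∑ r, P r * Q r := by
      intro σ
      have h1 : ∀ e ∈ (1 : MvPolynomial (Fin 2) ℂ).support, e = 0 := fun e he => by
        rw [support_one] at he
        exact Finset.mem_singleton.1 he
      have hprod : ∃ R : ℕ, R ≤ ∏ a, 2 ^ (rows (σ a)) ∧
          ∃ P Q : Fin R → MvPolynomial (Fin 2) ℂ, (∀ r, ∀ e ∈ (P r).support, e 1 = 0) ∧
            (∀ r, ∀ e ∈ (Q r).support, e 0 = 0) ∧
            ∏ a, Δ^[rows (σ a)] (X a * Y a) = ∑ r, P r * Q r := by
        refine Finset.prod_hom_rel (r := fun B m => ∃ R : ℕ, R ≤ B ∧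
            ∃ P Q : Fin R → MvPolynomial (Fin 2) ℂ, (∀ r, ∀ e ∈ (P r).support, e 1 = 0) ∧
              (∀ r, ∀ e ∈ (Q r).support, e 0 = 0) ∧ m = ∑ r, P r * Q r)
          (f := fun a => 2 ^ (rows (σ a))) (g := fun a => Δ^[rows (σ a)] (X a * Y a)) ?_ ?_
        · exact ⟨1, le_rfl, fun _ => 1, fun _ => 1, fun _ e he => by rw [h1 e he]; rfl,
            fun _ e he => by rw [h1 e he]; rfl, by simp⟩
        · rintro a B m ⟨R, hR, hm⟩
          obtain ⟨R', hR', hm'⟩ := hsep a (rows (σ a))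
          exact ⟨R' * R, Nat.mul_le_mul hR' hR, hex_sep_mul hm' hm⟩
      rw [Finset.prod_pow_eq_pow_sum, Equiv.sum_comp σ rows] at hprod
      obtain ⟨R, hR, hm⟩ := hprod
      rcases Int.units_eq_one_or (Equiv.Perm.sign σ) with h | h
      · rw [h, Units.val_one, Int.cast_one, one_mul]
        exact ⟨R, hR, hm⟩
      · rw [h, Units.val_neg, Units.val_one, Int.cast_neg, Int.cast_one, neg_one_mul]
        exact ⟨R, hR, hex_sep_neg hm⟩
    -- sum over the `s!` permutations: ranks add up
    have hcard : Nat.factorial s * 2 ^ (∑ a, rows a) =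
        ∑ _σ : Equiv.Perm (Fin s), 2 ^ (∑ a, rows a) := by
      rw [Finset.sum_const, Finset.card_univ, Fintype.card_perm, Fintype.card_fin, smul_eq_mul]
    rw [hcard]
    refine Finset.sum_hom_rel (r := fun B m => ∃ R : ℕ, R ≤ B ∧
        ∃ P Q : Fin R → MvPolynomial (Fin 2) ℂ, (∀ r, ∀ e ∈ (P r).support, e 1 = 0) ∧
          (∀ r, ∀ e ∈ (Q r).support, e 0 = 0) ∧ m = ∑ r, P r * Q r)
      (f := fun _ => 2 ^ (∑ a, rows a))
      (g := fun σ => ((Equiv.Perm.sign σ : ℤ) : MvPolynomial (Fin 2) ℂ) *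
        ∏ a, Δ^[rows (σ a)] (X a * Y a)) ?_ ?_
    · exact ⟨0, le_rfl, Fin.elim0, Fin.elim0, fun r => r.elim0, fun r => r.elim0, by simp⟩
    · rintro σ B m ⟨R, hR, hm⟩
      obtain ⟨R', hR', hm'⟩ := key σ
      exact ⟨R' + R, Nat.add_le_add hR' hR, hex_sep_add hm' hm⟩
  · rw [Matrix.det_apply', Finset.mul_sum]
    refine Finset.sum_congr rfl fun σ _ => ?_
    simp only [Matrix.of_apply, hiter]
    rw [Finset.prod_mul_distrib]
    ring


end Summit.ValiantsHypothesis.ValiantsHypothesis.Theorems.NewtonUnitEquationsNewtonTauWeak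

end
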